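import Mathlib
import Summits.ValiantsHypothesis.ValiantsHypothesis.Theorems.BarrierLeverPartitionMinorsHitByVPHiddenStatesBallCutThirdShell

/-!
# Route BarrierLever — item `PartitionMinorsHitByVP` (stmt-ValiantsHypothesis-19717), line `hidden-states`:
# ★★ THIRD SHELL — REDUCTION TO THE TOTALLY UNBALANCED CORES

Helper file (`--supports stmt-ValiantsHypothesis-19717`; cell valiant-natproofs, 𝒟-side door (c), registered line
`Cruxes/PartitionMinorsHitByVP/Lines/hidden_states.lean` v9; prover seat val-np-p6 gen 21).  Closes NO item; definition-free.

THE THEOREM (memo HOME/val-np-p6/g21/MEMO-valnp6-g21.md §4).  Call a 3-swap family `(A, C)` on `Fin n` (`|A_l| = t`, `|C_l| = t + 1`,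
injective, `A_l ⊄ C_{l'}`) TOTALLY UNBALANCED when EVERY coordinate `x : Fin n` has `#{l : x ∈ A_l} ≠ #{l : x ∈ C_l}` (in particular no
coordinate is free: the support is all of `Fin n`).  ★★ `exists_table_threeSwap_of_unbalanced`: IF every totally unbalanced 3-swap family
(every `n, t`) is served, THEN every 3-swap family is served (every `h, t`) — i.e. Conjecture S₃ (the whole third shell of every ball) is
EQUIVALENT to its restriction to the totally unbalanced cores.  PROOF = induction on the coordinate set `S ⊇ supp`: a coordinate of `S`
with `#A = #C = k` is cut exactly — `k = 0` free (`BallCut.served_of_erase_free`), `k = 3` (`BallCut.served_of_erase_balanced` with the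
LINK a 3-swap family one level down = induction, the DELETION the ball = zeta table `symGood_ball`), `k ∈ {1, 2}` (balanced cut with the
landed first/second shells on the coordinate set `S ∖ x`, `served_small_on`); if no coordinate of `S` is balanced the family is totally
unbalanced with support `S` and the hypothesis, pulled back along an enumeration of `S` and pushed forward by
`BallCut.served_image_of_served`, serves it.  STATUS OF THE CORES (val-np-p6 g21 census + kernel): at `t ≥ 3` no sampled family needs a
core argument (kit j327904/5/6: cut ∨ g20 path certificate = 100 %); at `t = 2` the cores found so far (supports 5, 6, 7) are ALL kernel
(`…ThirdShellCore25/26a/27a/27b/27c`, determinant certificates).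

HONEST LABEL: a reduction inside the conjecture column (third shell); 19717 stays OPEN; nothing on crux 14610 or VP ≠ VNP.
-/

set_option linter.dupNamespace false

namespace Summit.ValiantsHypothesis.ValiantsHypothesis.Theorems.BarrierLever.HiddenStates

open Finset

noncomputable section

namespace BallCut

open SymbJoin

variable {h : ℕ}

/-! ## 1. The ball (zeta table) and small swap families on an arbitrary coordinate set -/

/-- **The ball is served**: rows and columns the same family of sets (bijective enumerations) ⇒ generically good (zeta table). -/
theorem symGood_ball {r : ℕ} (v c : Fin r → Finset (Fin h)) (hv : Function.Injective v)
    (hrange : ∀ U, (∃ j, v j = U) ↔ ∃ j, c j = U) : symDet v (fun j => ((0 : Fin 1), c j)) ≠ 0 := by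
  classical
  have hrange' : Set.range c = Set.range v := by
    ext U; simp only [Set.mem_range]; exact (hrange U).symm
  obtain ⟨ρ, hρ⟩ := FullJoin.exists_perm_of_range_eq c v hv hrange'.symm
  rw [← exists_table_iff_symGood]
  let tx : Option (Fin h) → Fin h → ℂ := fun o a =>
    match o with
    | none => 0
    | some q => if q = a then 1 else 0
  refine ⟨tx, ?_⟩
  have hpt : ∀ j a, tx none a + ∑ q ∈ c j, tx (some q) a = if a ∈ c j then 1 else 0 := by
    intro j a
    simp only [tx, zero_add]
    rw [Finset.sum_ite_eq' (c j) a]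
  have hentry : ∀ i j, ∏ a ∈ v i, (tx none a + ∑ q ∈ c j, tx (some q) a) = if v i ⊆ c j then 1 else 0 := by
    intro i j
    simp_rw [hpt j]
    rw [Finset.prod_boole]
    by_cases hs : v i ⊆ c j
    · rw [if_pos hs, if_pos (fun a ha => hs ha)]
    · rw [if_neg hs, if_neg (fun hall => hs (fun a ha => hall a ha))]
  set P : Matrix (Fin r) (Fin r) ℂ := Matrix.of fun i k => if v i ⊆ v k then (1 : ℂ) else 0 with hP
  have hPunit : IsUnit P := FullJoin.inclusionMatrix_isUnit v hv
  have hM : (Matrix.of fun i j : Fin r => ∏ a ∈ v i, (tx none a + ∑ q ∈ c j, tx (some q) a))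
      = P.submatrix id (ρ.symm : Fin r → Fin r) := by
    ext i j
    rw [Matrix.of_apply, hentry, Matrix.submatrix_apply, hP, Matrix.of_apply, id, hρ (ρ.symm j), Equiv.apply_symm_apply]
  rw [hM, Matrix.det_permute', mul_ne_zero_iff]
  refine ⟨?_, (Matrix.isUnit_iff_isUnit_det P |>.1 hPunit).ne_zero⟩
  rcases Int.units_eq_one_or (Equiv.Perm.sign ρ.symm) with h1 | h1 <;> simp [h1]

/-- pulling a subset of `S` back along the increasing enumeration of `S` and pushing it forward gives the set back. -/
theorem map_preimage_orderEmb (S : Finset (Fin h)) (s : Finset (Fin h)) (hs : s ⊆ S) :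
    (s.preimage (S.orderEmbOfFin rfl).toEmbedding (S.orderEmbOfFin rfl).injective.injOn).map
      (S.orderEmbOfFin rfl).toEmbedding = s := by
  ext y
  rw [Finset.mem_map]
  constructor
  · rintro ⟨z, hz, rfl⟩; exact Finset.mem_preimage.1 hz
  · intro hy
    have : y ∈ Set.range (S.orderEmbOfFin rfl) := by rw [Finset.range_orderEmbOfFin]; exact hs hy
    obtain ⟨z, hz⟩ := this
    exact ⟨z, Finset.mem_preimage.2 (by rw [RelEmbedding.coe_toEmbedding, hz]; exact hy),
      by rw [RelEmbedding.coe_toEmbedding, hz]⟩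

/-- the image of the increasing enumeration of `S` is `S`. -/
theorem map_orderEmb_univ (S : Finset (Fin h)) :
    (Finset.univ : Finset (Fin S.card)).map (S.orderEmbOfFin rfl).toEmbedding = S := by
  ext y
  simp only [Finset.mem_map, Finset.mem_univ, true_and, RelEmbedding.coe_toEmbedding]
  rw [← Set.mem_range (f := (S.orderEmbOfFin rfl)), Finset.range_orderEmbOfFin, Finset.mem_coe]

/-- **Small swap families on an arbitrary coordinate set are served**: `k ∈ {1, 2}` swaps with `A_l, C_l ⊆ S`, bijective-enumeration
form on `S` (the landed first and second shells pulled back to `Fin |S|` and pushed forward). -/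
theorem served_small_on (t : ℕ) (S : Finset (Fin h)) {k : ℕ} (hk : k = 1 ∨ k = 2) (A C : Fin k → Finset (Fin h))
    (hA : ∀ l, (A l).card = t) (hC : ∀ l, (C l).card = t + 1)
    (hAi : Function.Injective A) (hCi : Function.Injective C) (hAC : ∀ l l', ¬ A l ⊆ C l')
    (hAS : ∀ l, A l ⊆ S) (hCS : ∀ l, C l ⊆ S)
    {r : ℕ} (u cols : Fin r → Finset (Fin h)) (hu : Function.Injective u)
    (hU : ∀ U, (∃ i, u i = U) ↔ ((U ⊆ S ∧ U.card ≤ t ∧ ∀ l, U ≠ A l) ∨ ∃ l, U = C l))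
    (hJ : ∀ J, (∃ kk, cols kk = J) ↔ (J ⊆ S ∧ J.card ≤ t)) :
    symDet u (fun kk => ((0 : Fin 1), cols kk)) ≠ 0 := by
  classical
  set σ := (S.orderEmbOfFin rfl).toEmbedding with hσ
  let A' : Fin k → Finset (Fin S.card) := fun l => (A l).preimage σ σ.injective.injOn
  let C' : Fin k → Finset (Fin S.card) := fun l => (C l).preimage σ σ.injective.injOn
  have hA' : ∀ l, (A' l).map σ = A l := fun l => map_preimage_orderEmb S (A l) (hAS l)
  have hC' : ∀ l, (C' l).map σ = C l := fun l => map_preimage_orderEmb S (C l) (hCS l)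
  have hA'c : ∀ l, (A' l).card = t := fun l => by rw [← Finset.card_map σ, hA' l, hA l]
  have hC'c : ∀ l, (C' l).card = t + 1 := fun l => by rw [← Finset.card_map σ, hC' l, hC l]
  have hA'i : Function.Injective A' := fun l l' hll' => hAi (by rw [← hA' l, ← hA' l']; exact congrArg _ hll')
  have hC'i : Function.Injective C' := fun l l' hll' => hCi (by rw [← hC' l, ← hC' l']; exact congrArg _ hll')
  have hA'C' : ∀ l l', ¬ A' l ⊆ C' l' := fun l l' hsub => hAC l l' (by
    rw [← hA' l, ← hC' l']; exact Finset.map_subset_map.2 hsub)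
  refine served_image_of_served S.card t σ A' C'
    (fun r u cols hu hU hcols => served_smallSwap S.card t hk A' C' hA'c hC'c hA'i hC'i hA'C' u cols hu hU hcols)
    u cols hu ?_ ?_
  · intro U
    rw [hU U, hσ, map_orderEmb_univ]
    simp only [← hσ, hA', hC']
  · intro J
    rw [hJ J, hσ, map_orderEmb_univ]

/-! ## 2. The induction on the coordinate set -/

/-- **Every 3-swap family inside `S` is served on `S`, given that the totally unbalanced ones are served** (induction on `|S|`). -/
theorem served_threeSwap_on_of_unbalanced
    (H : ∀ (n t : ℕ) (A C : Fin 3 → Finset (Fin n)), (∀ l, (A l).card = t) → (∀ l, (C l).card = t + 1) →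
      Function.Injective A → Function.Injective C → (∀ l l', ¬ A l ⊆ C l') →
      (∀ x : Fin n, (Finset.univ.filter fun l => x ∈ A l).card ≠ (Finset.univ.filter fun l => x ∈ C l).card) →
      ∀ ⦃r : ℕ⦄ (u cols : Fin r → Finset (Fin n)), Function.Injective u →
        (∀ i, ((u i).card ≤ t ∧ ∀ l, u i ≠ A l) ∨ ∃ l, u i = C l) →
        (∀ J : Finset (Fin n), J.card ≤ t → ∃ kk, cols kk = J) →
        ∃ tx : Option (Fin n) → Fin n → ℂ,
          (Matrix.of fun i kk : Fin r => ∏ a ∈ u i, (tx none a + ∑ q ∈ cols kk, tx (some q) a)).det ≠ 0)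
    (n : ℕ) : ∀ (S : Finset (Fin h)), S.card = n → ∀ (t : ℕ) (A C : Fin 3 → Finset (Fin h)),
      (∀ l, (A l).card = t) → (∀ l, (C l).card = t + 1) → Function.Injective A → Function.Injective C →
      (∀ l l', ¬ A l ⊆ C l') → (∀ l, A l ⊆ S) → (∀ l, C l ⊆ S) →
      ∀ ⦃r : ℕ⦄ (u cols : Fin r → Finset (Fin h)), Function.Injective u → Function.Injective cols →
        (∀ U, (∃ i, u i = U) ↔ ((U ⊆ S ∧ U.card ≤ t ∧ ∀ l, U ≠ A l) ∨ ∃ l, U = C l)) →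
        (∀ J, (∃ kk, cols kk = J) ↔ (J ⊆ S ∧ J.card ≤ t)) →
        symDet u (fun kk => ((0 : Fin 1), cols kk)) ≠ 0 := by
  classical
  induction n with
  | zero =>
    intro S hS t A C hA hC hAi hCi hAC hAS hCS r u cols hu hcinj hU hJ
    have hA0 : ∀ l, A l = ∅ := fun l => Finset.subset_empty.1 (by rw [← Finset.card_eq_zero.1 hS]; exact hAS l)
    exact absurd (hAi ((hA0 0).trans (hA0 1).symm)) (by decide)
  | succ n ih =>
    intro S hS t A C hA hC hAi hCi hAC hAS hCS r u cols hu hcinj hU hJ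
    by_cases hbal : ∃ x ∈ S, (Finset.univ.filter fun l => x ∈ A l).card = (Finset.univ.filter fun l => x ∈ C l).card
    · obtain ⟨x, hxS, hx⟩ := hbal
      have hS' : (S.erase x).card = n := by rw [Finset.card_erase_of_mem hxS, hS]; rfl
      obtain ⟨k, hk⟩ : ∃ k, (Finset.univ.filter fun l => x ∈ A l).card = k := ⟨_, rfl⟩
      have hkC : (Finset.univ.filter fun l => x ∈ C l).card = k := by rw [← hx]; exact hk
      have hk3 : k ≤ 3 := by
        have := Finset.card_filter_le (Finset.univ : Finset (Fin 3)) (fun l => x ∈ A l)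
        rw [hk] at this; simpa using this
      rcases (by omega : k = 0 ∨ k = 3 ∨ (k = 1 ∨ k = 2)) with hk0 | hk3' | hk12
      · -- `k = 0`: `x` is free
        have hxA : ∀ l, x ∉ A l := by
          have hE := Finset.card_eq_zero.1 (hk.trans hk0)
          intro l hl
          exact (Finset.filter_eq_empty_iff.1 hE) (Finset.mem_univ l) hl
        have hxC : ∀ l, x ∉ C l := by
          have hE := Finset.card_eq_zero.1 (hkC.trans hk0)
          intro l hl
          exact (Finset.filter_eq_empty_iff.1 hE) (Finset.mem_univ l) hl
        have hAS' : ∀ l, A l ⊆ S.erase x := fun l a ha => Finset.mem_erase.2 ⟨fun hax => hxA l (hax ▸ ha), hAS l ha⟩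
        have hCS' : ∀ l, C l ⊆ S.erase x := fun l a ha => Finset.mem_erase.2 ⟨fun hax => hxC l (hax ▸ ha), hCS l ha⟩
        exact served_of_erase_free t A C hA hC hAi hCi S x hAS' hCS'
          (ih (S.erase x) hS' t A C hA hC hAi hCi hAC hAS' hCS') u cols hu hcinj hU hJ
      · -- `k = 3`: every swap passes through `x`; the link is a 3-swap family one level down, the deletion is the ball
        have hxA : ∀ l, x ∈ A l := by
          have hfull : (Finset.univ.filter fun l => x ∈ A l) = Finset.univ :=
            Finset.eq_univ_of_card _ (by rw [hk, hk3']; simp)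
          intro l; have := hfull ▸ Finset.mem_univ l; exact (Finset.mem_filter.1 this).2
        have hxC : ∀ l, x ∈ C l := by
          have hfull : (Finset.univ.filter fun l => x ∈ C l) = Finset.univ :=
            Finset.eq_univ_of_card _ (by rw [hkC, hk3']; simp)
          intro l; have := hfull ▸ Finset.mem_univ l; exact (Finset.mem_filter.1 this).2
        obtain ⟨t', rfl⟩ : ∃ t', t = t' + 1 :=
          ⟨t - 1, by have := Finset.card_pos.2 ⟨x, hxA 0⟩; rw [hA 0] at this; omega⟩
        -- the link family
        let A' : Fin 3 → Finset (Fin h) := fun l => (A l).erase x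
        let C' : Fin 3 → Finset (Fin h) := fun l => (C l).erase x
        have hA' : ∀ l, (A' l).card = t' := fun l => by
          have := Finset.card_erase_of_mem (hxA l); simp only [A']; rw [this, hA]; rfl
        have hC' : ∀ l, (C' l).card = t' + 1 := fun l => by
          have := Finset.card_erase_of_mem (hxC l); simp only [C']; rw [this, hC]; rfl
        have hA'i : Function.Injective A' := by
          intro l l' hll'
          have h1 : A l = A l' := by
            rw [← Finset.insert_erase (hxA l), ← Finset.insert_erase (hxA l')]; exact congrArg _ hll'
          exact hAi h1
        have hC'i : Function.Injective C' := by
          intro l l' hll'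
          have h1 : C l = C l' := by
            rw [← Finset.insert_erase (hxC l), ← Finset.insert_erase (hxC l')]; exact congrArg _ hll'
          exact hCi h1
        have hA'C' : ∀ l l', ¬ A' l ⊆ C' l' := fun l l' hsub => hAC l l' (by
          rw [← Finset.insert_erase (hxA l), ← Finset.insert_erase (hxC l')]
          exact Finset.insert_subset_insert x hsub)
        have hA'S : ∀ l, A' l ⊆ S.erase x := fun l => Finset.erase_subset_erase x (hAS l)
        have hC'S : ∀ l, C' l ⊆ S.erase x := fun l => Finset.erase_subset_erase x (hCS l)
        refine served_of_erase_balanced t' A C hA hC hAi hCi S x hxS hAS hx ?_ ?_ u cols hu hcinj hU hJ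
        · -- Hlink from the induction hypothesis
          intro r' u' cols' hu' hc' hU' hJ'
          refine ih (S.erase x) hS' t' A' C' hA' hC' hA'i hC'i hA'C' hA'S hC'S u' cols' hu' hc' (fun U => ?_) hJ'
          rw [hU' U]
          rw [show (∀ l, x ∈ A l → U ≠ (A l).erase x) ↔ ∀ l, U ≠ A' l from ⟨fun H' l => H' l (hxA l), fun H' l _ => H' l⟩,
            show (∃ l, x ∈ C l ∧ U = (C l).erase x) ↔ ∃ l, U = C' l from
              ⟨fun ⟨l, _, hl⟩ => ⟨l, hl⟩, fun ⟨l, hl⟩ => ⟨l, hxC l, hl⟩⟩]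
        · -- Hdel: the ball `B_{t'+1}(S.erase x)`
          intro r' u' cols' hu' hc' hU' hJ'
          refine symGood_ball u' cols' hu' fun U => ?_
          rw [hU' U, hJ' U]
          constructor
          · rintro (⟨h1, h2, -⟩ | ⟨l, hl, -⟩)
            · exact ⟨h1, h2⟩
            · exact absurd (hxC l) hl
          · rintro ⟨h1, h2⟩
            exact Or.inl ⟨h1, h2, fun l hl => absurd (hxA l) hl⟩
      · -- `k ∈ {1, 2}`: balanced cut with the landed first and second shells
        have hne : (Finset.univ.filter fun l => x ∈ A l).Nonempty := by
          rw [← Finset.card_pos]; rcases hk12 with h1 | h2 <;> omega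
        obtain ⟨l₀, hl₀⟩ := hne
        have hxl₀ : x ∈ A l₀ := (Finset.mem_filter.1 hl₀).2
        obtain ⟨t', rfl⟩ : ∃ t', t = t' + 1 :=
          ⟨t - 1, by have := Finset.card_pos.2 ⟨x, hxl₀⟩; rw [hA l₀] at this; omega⟩
        refine served_of_erase_balanced t' A C hA hC hAi hCi S x hxS hAS hx ?_ ?_ u cols hu hcinj hU hJ
        · -- THE LINK: the `k` swaps through `x`, `x` erased, level `t'`
          intro r' u' cols' hu' hc' hU' hJ'
          let eA : Fin k ↪o Fin 3 := (Finset.univ.filter fun l : Fin 3 => x ∈ A l).orderEmbOfFin hk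
          let eC : Fin k ↪o Fin 3 := (Finset.univ.filter fun l : Fin 3 => x ∈ C l).orderEmbOfFin hkC
          have heA : ∀ j, x ∈ A (eA j) := fun j => by
            have hm : eA j ∈ Finset.univ.filter (fun l : Fin 3 => x ∈ A l) := Finset.orderEmbOfFin_mem _ hk j
            exact (Finset.mem_filter.1 hm).2
          have heC : ∀ j, x ∈ C (eC j) := fun j => by
            have hm : eC j ∈ Finset.univ.filter (fun l : Fin 3 => x ∈ C l) := Finset.orderEmbOfFin_mem _ hkC j
            exact (Finset.mem_filter.1 hm).2
          have heAsur : ∀ l, x ∈ A l → ∃ j, eA j = l := fun l hl => by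
            have : l ∈ Set.range eA := by
              rw [show Set.range eA = ↑(Finset.univ.filter fun l : Fin 3 => x ∈ A l) from
                Finset.range_orderEmbOfFin _ hk]; simp [hl]
            exact this
          have heCsur : ∀ l, x ∈ C l → ∃ j, eC j = l := fun l hl => by
            have : l ∈ Set.range eC := by
              rw [show Set.range eC = ↑(Finset.univ.filter fun l : Fin 3 => x ∈ C l) from
                Finset.range_orderEmbOfFin _ hkC]; simp [hl]
            exact this
          let A₁ : Fin k → Finset (Fin h) := fun j => (A (eA j)).erase x
          let C₁ : Fin k → Finset (Fin h) := fun j => (C (eC j)).erase x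
          have hA₁ : ∀ j, (A₁ j).card = t' := fun j => by
            have := Finset.card_erase_of_mem (heA j); simp only [A₁]; rw [this, hA]; rfl
          have hC₁ : ∀ j, (C₁ j).card = t' + 1 := fun j => by
            have := Finset.card_erase_of_mem (heC j); simp only [C₁]; rw [this, hC]; rfl
          have hA₁i : Function.Injective A₁ := by
            intro j j' hjj'
            have h1 : A (eA j) = A (eA j') := by
              rw [← Finset.insert_erase (heA j), ← Finset.insert_erase (heA j')]; exact congrArg _ hjj'
            exact eA.injective (hAi h1)
          have hC₁i : Function.Injective C₁ := by
            intro j j' hjj'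
            have h1 : C (eC j) = C (eC j') := by
              rw [← Finset.insert_erase (heC j), ← Finset.insert_erase (heC j')]; exact congrArg _ hjj'
            exact eC.injective (hCi h1)
          have hA₁C₁ : ∀ j j', ¬ A₁ j ⊆ C₁ j' := fun j j' hsub => hAC (eA j) (eC j') (by
            rw [← Finset.insert_erase (heA j), ← Finset.insert_erase (heC j')]
            exact Finset.insert_subset_insert x hsub)
          refine served_small_on t' (S.erase x) hk12 A₁ C₁ hA₁ hC₁ hA₁i hC₁i hA₁C₁
            (fun j => Finset.erase_subset_erase x (hAS _)) (fun j => Finset.erase_subset_erase x (hCS _))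
            u' cols' hu' (fun U => ?_) hJ'
          rw [hU' U]
          have e1 : (∀ l, x ∈ A l → U ≠ (A l).erase x) ↔ ∀ j, U ≠ A₁ j := by
            constructor
            · intro H' j; exact H' (eA j) (heA j)
            · intro H' l hl; obtain ⟨j, rfl⟩ := heAsur l hl; exact H' j
          have e2 : (∃ l, x ∈ C l ∧ U = (C l).erase x) ↔ ∃ j, U = C₁ j := by
            constructor
            · rintro ⟨l, hl, hU''⟩; obtain ⟨j, rfl⟩ := heCsur l hl; exact ⟨j, hU''⟩
            · rintro ⟨j, hU''⟩; exact ⟨eC j, heC j, hU''⟩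
          rw [e1, e2]
        · -- THE DELETION: the `3 - k` swaps avoiding `x`, level `t' + 1`
          intro r' u' cols' hu' hc' hU' hJ'
          obtain ⟨k', hk'⟩ : ∃ k', (Finset.univ.filter fun l : Fin 3 => x ∉ A l).card = k' := ⟨_, rfl⟩
          have hk3'' : k + k' = 3 := by
            have := Finset.card_filter_add_card_filter_not (s := (Finset.univ : Finset (Fin 3))) (fun l => x ∈ A l)
            rw [hk, hk'] at this; simpa using this
          have hICk : (Finset.univ.filter fun l : Fin 3 => x ∉ C l).card = k' := by
            have := Finset.card_filter_add_card_filter_not (s := (Finset.univ : Finset (Fin 3))) (fun l => x ∈ C l)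
            rw [hkC] at this
            simp only [Finset.card_univ, Fintype.card_fin] at this
            omega
          have hkk : k' = 1 ∨ k' = 2 := by rcases hk12 with h1 | h2 <;> omega
          let eA : Fin k' ↪o Fin 3 := (Finset.univ.filter fun l : Fin 3 => x ∉ A l).orderEmbOfFin hk'
          let eC : Fin k' ↪o Fin 3 := (Finset.univ.filter fun l : Fin 3 => x ∉ C l).orderEmbOfFin hICk
          have heA : ∀ j, x ∉ A (eA j) := fun j => by
            have hm : eA j ∈ Finset.univ.filter (fun l : Fin 3 => x ∉ A l) := Finset.orderEmbOfFin_mem _ hk' j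
            exact (Finset.mem_filter.1 hm).2
          have heC : ∀ j, x ∉ C (eC j) := fun j => by
            have hm : eC j ∈ Finset.univ.filter (fun l : Fin 3 => x ∉ C l) := Finset.orderEmbOfFin_mem _ hICk j
            exact (Finset.mem_filter.1 hm).2
          have heAsur : ∀ l, x ∉ A l → ∃ j, eA j = l := fun l hl => by
            have : l ∈ Set.range eA := by
              rw [show Set.range eA = ↑(Finset.univ.filter fun l : Fin 3 => x ∉ A l) from
                Finset.range_orderEmbOfFin _ hk']; simp [hl]
            exact this
          have heCsur : ∀ l, x ∉ C l → ∃ j, eC j = l := fun l hl => by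
            have : l ∈ Set.range eC := by
              rw [show Set.range eC = ↑(Finset.univ.filter fun l : Fin 3 => x ∉ C l) from
                Finset.range_orderEmbOfFin _ hICk]; simp [hl]
            exact this
          let A₂ : Fin k' → Finset (Fin h) := fun j => A (eA j)
          let C₂ : Fin k' → Finset (Fin h) := fun j => C (eC j)
          refine served_small_on (t' + 1) (S.erase x) hkk A₂ C₂ (fun j => hA _) (fun j => hC _)
            (fun j j' hjj' => eA.injective (hAi hjj')) (fun j j' hjj' => eC.injective (hCi hjj'))
            (fun j j' => hAC _ _)
            (fun j a ha => Finset.mem_erase.2 ⟨fun hax => heA j (hax ▸ ha), hAS _ ha⟩)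
            (fun j a ha => Finset.mem_erase.2 ⟨fun hax => heC j (hax ▸ ha), hCS _ ha⟩)
            u' cols' hu' (fun U => ?_) hJ'
          rw [hU' U]
          have e1 : (∀ l, x ∉ A l → U ≠ A l) ↔ ∀ j, U ≠ A₂ j := by
            constructor
            · intro H' j; exact H' (eA j) (heA j)
            · intro H' l hl; obtain ⟨j, rfl⟩ := heAsur l hl; exact H' j
          have e2 : (∃ l, x ∉ C l ∧ U = C l) ↔ ∃ j, U = C₂ j := by
            constructor
            · rintro ⟨l, hl, hU''⟩; obtain ⟨j, rfl⟩ := heCsur l hl; exact ⟨j, hU''⟩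
            · rintro ⟨j, hU''⟩; exact ⟨eC j, heC j, hU''⟩
          rw [e1, e2]
    · -- no balanced coordinate in `S`: the family is totally unbalanced with support `S`
      push Not at hbal
      set σ := (S.orderEmbOfFin rfl).toEmbedding with hσ
      let A' : Fin 3 → Finset (Fin S.card) := fun l => (A l).preimage σ σ.injective.injOn
      let C' : Fin 3 → Finset (Fin S.card) := fun l => (C l).preimage σ σ.injective.injOn
      have hA' : ∀ l, (A' l).map σ = A l := fun l => map_preimage_orderEmb S (A l) (hAS l)
      have hC' : ∀ l, (C' l).map σ = C l := fun l => map_preimage_orderEmb S (C l) (hCS l)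
      have hA'c : ∀ l, (A' l).card = t := fun l => by rw [← Finset.card_map σ, hA' l, hA l]
      have hC'c : ∀ l, (C' l).card = t + 1 := fun l => by rw [← Finset.card_map σ, hC' l, hC l]
      have hA'i : Function.Injective A' := fun l l' hll' => hAi (by rw [← hA' l, ← hA' l']; exact congrArg _ hll')
      have hC'i : Function.Injective C' := fun l l' hll' => hCi (by rw [← hC' l, ← hC' l']; exact congrArg _ hll')
      have hA'C' : ∀ l l', ¬ A' l ⊆ C' l' := fun l l' hsub => hAC l l' (by
        rw [← hA' l, ← hC' l']; exact Finset.map_subset_map.2 hsub)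
      have hunb : ∀ y : Fin S.card, (Finset.univ.filter fun l => y ∈ A' l).card ≠
          (Finset.univ.filter fun l => y ∈ C' l).card := by
        intro y
        have hyS : σ y ∈ S := by
          have : σ y ∈ Set.range (S.orderEmbOfFin rfl) := ⟨y, rfl⟩
          rw [Finset.range_orderEmbOfFin] at this; exact this
        have e1 : (Finset.univ.filter fun l => y ∈ A' l) = Finset.univ.filter fun l => σ y ∈ A l := by
          ext l; simp [A', Finset.mem_preimage]
        have e2 : (Finset.univ.filter fun l => y ∈ C' l) = Finset.univ.filter fun l => σ y ∈ C l := by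
          ext l; simp [C', Finset.mem_preimage]
        rw [e1, e2]; exact hbal (σ y) hyS
      refine served_image_of_served S.card t σ A' C' (H S.card t A' C' hA'c hC'c hA'i hC'i hA'C' hunb) u cols hu ?_ ?_
      · intro U
        rw [hU U, hσ, map_orderEmb_univ]
        simp only [← hσ, hA', hC']
      · intro J
        rw [hJ J, hσ, map_orderEmb_univ]

/-! ## 3. ★★ The reduction -/

/-- ★★ **THIRD SHELL: REDUCTION TO THE TOTALLY UNBALANCED CORES.**  If every totally unbalanced 3-swap family (every coordinate in
unequally many `A_l` and `C_l`) is served on its support, then EVERY 3-swap family is served, for all `h, t`. -/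
theorem exists_table_threeSwap_of_unbalanced
    (H : ∀ (n t : ℕ) (A C : Fin 3 → Finset (Fin n)), (∀ l, (A l).card = t) → (∀ l, (C l).card = t + 1) →
      Function.Injective A → Function.Injective C → (∀ l l', ¬ A l ⊆ C l') →
      (∀ x : Fin n, (Finset.univ.filter fun l => x ∈ A l).card ≠ (Finset.univ.filter fun l => x ∈ C l).card) →
      ∀ ⦃r : ℕ⦄ (u cols : Fin r → Finset (Fin n)), Function.Injective u →
        (∀ i, ((u i).card ≤ t ∧ ∀ l, u i ≠ A l) ∨ ∃ l, u i = C l) →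
        (∀ J : Finset (Fin n), J.card ≤ t → ∃ kk, cols kk = J) →
        ∃ tx : Option (Fin n) → Fin n → ℂ,
          (Matrix.of fun i kk : Fin r => ∏ a ∈ u i, (tx none a + ∑ q ∈ cols kk, tx (some q) a)).det ≠ 0)
    (h t : ℕ) (A C : Fin 3 → Finset (Fin h))
    (hA : ∀ l, (A l).card = t) (hC : ∀ l, (C l).card = t + 1)
    (hAi : Function.Injective A) (hCi : Function.Injective C) (hAC : ∀ l l', ¬ A l ⊆ C l')
    {r : ℕ} (u cols : Fin r → Finset (Fin h)) (hu : Function.Injective u)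
    (hU : ∀ i, ((u i).card ≤ t ∧ ∀ l, u i ≠ A l) ∨ ∃ l, u i = C l)
    (hcols : ∀ J : Finset (Fin h), J.card ≤ t → ∃ kk, cols kk = J) :
    ∃ tx : Option (Fin h) → Fin h → ℂ,
      (Matrix.of fun i kk : Fin r => ∏ a ∈ u i, (tx none a + ∑ q ∈ cols kk, tx (some q) a)).det ≠ 0 := by
  classical
  obtain ⟨hcinj, hUr, hJr⟩ := rigidity t A C hA hC hAi hCi u cols hu hU hcols
  rw [exists_table_iff_symGood]
  exact served_threeSwap_on_of_unbalanced H _ Finset.univ rfl t A C hA hC hAi hCi hAC (fun l => Finset.subset_univ _)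
    (fun l => Finset.subset_univ _) u cols hu hcinj (fun U => by rw [hUr U]; simp) (fun J => by rw [hJr J]; simp)

end BallCut

end

end Summit.ValiantsHypothesis.ValiantsHypothesis.Theorems.BarrierLever.HiddenStates
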